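/-
Copyright (c) 2026 the pub-hodgecm-mathlib formalisation cell (harness21).  Prover seat hodgecm-mathlib-LH4-p08 (g9), req620 Track A «(D-RAM) FOUR-FRAME» squad, helper lane
on h413 = stmt-HodgeConjecture-24833 (count-neutral).  STAGE-1b, row (2), type-U lane of the (LAW) END (second hand to LH4-p07 (g9)).  2026-09-04.
-/
import Summits.HodgeConjecture.HodgeConjecture.Theorems.F0P3cDyRamLevelOrderCountsUnrWeldCut          -- ★ p860069 (this lineage, g8): (OC-weldΔ)-Unr, both lanes
import Summits.HodgeConjecture.HodgeConjecture.Theorems.F0P3cDyRamLevelsCensusLawArithUnrGeneric     -- (this seat): generic closing arithmetic + inert `ℤ` bottom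
import Summits.HodgeConjecture.HodgeConjecture.Theorems.F0P3cDyRamConeWeightHalfSplitMultiplier      -- ★ p859752 (LH4-p11 (g7)): (β′) `finsum_levelSetDep_weight_eq_pow_mul_ncard_of_eq_mul`, §1
import Summits.HodgeConjecture.HodgeConjecture.Theorems.F0P3cDyRamToricLevelCensusUnrAtThirdField     -- ★ (LH4-p07 (g7)): `completeSpace_of_v_map_eq_of_range_eq_fixed`; brings ★ S2′ `exists_thirdFieldPackage_unr`
import Literature.NumberTheory.LocalFields.ValuedCompleteIsAdicComplete                           -- ★ BRIDGE-AC `isAdicComplete_valuedInteger_of_completeSpace`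
import HarnessLib

/-!
# Crux `H413`, line LH4 «(D-RAM) FOUR-FRAME» — STAGE-1b, row (2): (LAW-frame)-Unr «THE TWO-LITERAL LAW OF A GENERIC LEVEL PIECE AT THE TYPE-U FRAME, CUTOFF CURRENCY»
# `(q − 1)·q^{ks}·(cutCnt_h − cutCnt_{h′}) = ε·q^m·((q − 1)F + 2 − 2q^T)`

Cell `hodgecm-mathlib` (D-0151), FLOOR 0, crux item H413 = `stmt-HodgeConjecture-24833`, route of record `HCCMUnconditional`; squad F0∕P3c∕LH4 (req618∕req620); helper lane
`--supports stmt-HodgeConjecture-24833 --as helper` (count-neutral).  ONE THEOREM (no `def`, no instance, no notation, no `sorry`).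

THE OBJECT.  The type-U level socket `levelsCensusA` (this seat; SIG `SIG-levelsCensusA.skel.v1` 42046bc8) reads the level-piece census of each literal at the CM place through
★ p860083 `ncard_typeZero_fixed_{endoGL,conj_endoGL}_levels_eq_cutoff_unr` in CUTOFF currency:
`cutCnt_X = Σ_{j ≤ jλ − a} #levelSet_X(j, 0) + Σ_{b′ ∈ Icc 1 R_X} Σ_{j ≤ jλ − a} [j + b′ + nν ≤ m₂ + jλ]·Σᶠ_{Λ ∈ levelSetDep_X(j, b′; μ₁)} f_X b′ j Λ`, `μ₁ = (jE ϖ^a)⁻¹(λ − jE u)`.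
THIS FILE is everything AFTER that reading, stated in the abstract two-field frame (`E` ↝ `L_w` with its wild datum `(σ, ϖ, d, t)`; `M` ↝ `E′_{w₁}` of TYPE U with
`(ρ, Θ, α)`, `jE`, the two line models `(φ, h)` hyperbolic ∕ `(φ′, h′)` anisotropic, the flip unit `z·Θz = jE ξ`, the weights `f, f′` with ★ (C1)'s agreement clauses) — no CM
place, no `γ_H`:  **`levelsCutCensus_unr_law_of_frame`** ⊢ `(q − 1)·q^{ks}·((cutCnt_h : ℤ) − cutCnt_{h′}) = ε·q^m·((q − 1)F + 2 − 2q^T)` from the tokens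
`|λ − jE u| = exp(−m)`, `|(λ − jE u) − ρ(λ − jE u)| = exp(−jλ)` (`jλ` even), ★ T5s-U's realizability branches for `ε = ±1`, the piece `(a, b, ks, T)` under LH4-p07 (g9)'s
rule (`hks`, `hT0`, `hT1`, `d + 2a ≤ b + 1`), the near-1 threshold `a + b + d ≤ m`, the second token letter `m₂ + b = m + nν`, the unscaled cell-depth bounds `R, R′`
and the INERT H-side law `(q − 1)F + 2 = (q + 1)q^{jλ∕2}`.
PROOF = composition of ★ organs: the third field of type U (★ S2′ `exists_thirdFieldPackage_unr`, completeness ★ `completeSpace_of_v_map_eq_of_range_eq_fixed` ∘ ★ BRIDGE-AC);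
`λ`'s order filtration (★ `isOrd_pow_iff_le`); scaled cells ⊆ unit cells (★ (β′) §1 `levelSetDep_subset_of_eq_mul`, `κ = jE ϖ^a`) for the depth bounds; the cutoff letter
`j + b′ + nν ≤ m₂ + jλ ⟺ j + b′ ≤ C := m + jλ − b` and the cone weight `Σᶠ f = q^{b′}·#cell` (★ (β′) `finsum_levelSetDep_weight_eq_pow_mul_ncard_of_eq_mul`) cell by cell;
★ p860069 `levelOrderCounts_unr_weld_cut{,_flip}` (lane by `a % 2`, scaled tokens `(m − a, jλ − a)`, `tc = jE ϖ^a`); ★ `law_arith_unr_std ∕ _flip`; ★ `levels_bottom_arith_inert`.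
HONEST LABEL.  Count-neutral; no CM place, no tier-0 row; `HC_CM` is proved only modulo the 7 printed citations (2 remaining named inputs: hLiu418 = `stmt-HodgeConjecture-24832`,
h413 = `stmt-HodgeConjecture-24833`) until rung 0 closes.

## References
* [Kottwitz1986BaseChangeUnits] R. E. Kottwitz, *Base change for unit elements of Hecke algebras*, Compositio Math. 60 (1986): §1 pp. 240–241.
* [Rogawski1990] J. D. Rogawski, *Automorphic Representations of Unitary Groups in Three Variables*, Ann. of Math. Stud. 123 (1990): §4.9 Prop. 4.9.1 (b) p. 55, Lemma 4.9.3 p. 56.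
* [LabesseLanglands1979] J.-P. Labesse, R. P. Langlands, *L-indistinguishability for SL(2)*, Canad. J. Math. 31 (1979): §2 pp. 8–10.
* [Serre1979] J.-P. Serre, *Local Fields*, GTM 67 (1979): Ch. II §1; Ch. V §3 Prop. 5, Cor. 2–3.
* [Flicker1998UnitaryFL] Y. Z. Flicker, *Elementary proof of the fundamental lemma for a unitary group*, Canad. J. Math. 50 (1998): Prop. 7 p. 84.
-/

set_option autoImplicit false

noncomputable section

open scoped Valued WithZero Matrix MatrixGroups Classical
open WithZero IsLocalRing Finset
open Literature.NumberTheory.Automorphic Literature.NumberTheory.Automorphic.HermitianLattice Literature.NumberTheory.Automorphic.UnitaryLatticeTree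
open Literature.NumberTheory.Automorphic.UnitaryThreeFourFrame (IsRamifiedQuadraticDatum)
open Literature.NumberTheory.Automorphic.EllipticPlaneAsFieldLine
open Literature.NumberTheory.LocalFields.QuadraticOrder
open Literature.NumberTheory.LocalFields (isAdicComplete_valuedInteger_of_completeSpace)
open Summit.HodgeConjecture.HodgeConjecture.Cruxes.H413.F0P3cDyRamToricCensusDefs
open Summit.HodgeConjecture.HodgeConjecture.Cruxes.H413.F0P3cDyRamConeWeightHalfSplitMultiplier (finsum_levelSetDep_weight_eq_pow_mul_ncard_of_eq_mul isOrd_of_map_eq_self levelSetDep_subset_of_eq_mul)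
open Summit.HodgeConjecture.HodgeConjecture.Cruxes.H413.F0P3cDyRamOrderFiltrationRange (isOrd_pow_iff_le)
open Summit.HodgeConjecture.HodgeConjecture.Cruxes.H413.F0P3cDyRamThirdFieldPackageUnr (exists_thirdFieldPackage_unr)
open Summit.HodgeConjecture.HodgeConjecture.Cruxes.H413.F0P3cDyRamToricLevelCensusUnrAtThirdField (completeSpace_of_v_map_eq_of_range_eq_fixed)
open Summit.HodgeConjecture.HodgeConjecture.Cruxes.H413.F0P3cDyRamLevelOrderCountsUnrWeldCut (levelOrderCounts_unr_weld_cut levelOrderCounts_unr_weld_cut_flip)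
open Summit.HodgeConjecture.HodgeConjecture.Cruxes.H413.F0P3cDyRamLevelsCensusLawArithUnrGeneric (law_arith_unr_std law_arith_unr_flip levels_bottom_arith_inert)

namespace Summit.HodgeConjecture.HodgeConjecture.Cruxes.H413.F0P3cDyRamLevelsCensusUnrFrameLaw

variable {E : Type} [Field E] [Valued E ℤᵐ⁰] {M : Type} [Field M] [Valued M ℤᵐ⁰] {ρ Θ : M →+* M} {α : M}

set_option maxHeartbeats 1600000 in
-- budget only: two copies of the (β′) frame and of ★ (C1)'s weight clause in the binders, two weld instantiations with ≈ 45 explicit arguments each (no search).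
/-- **(LAW-frame)-Unr — THE TWO-LITERAL LAW OF A GENERIC LEVEL PIECE AT THE TYPE-U FRAME, CUTOFF CURRENCY** (see the module docstring for the frame and the organs):
`(q − 1)·q^{ks}·((cutCnt_h : ℤ) − cutCnt_{h′}) = ε·q^m·((q − 1)F + 2 − 2q^T)`.
[cite: Kottwitz1986BaseChangeUnits, §1 pp. 240–241] [cite: Rogawski1990, §4.9 Prop. 4.9.1 (b) p. 55, Lemma 4.9.3 p. 56] [cite: LabesseLanglands1979, §2 pp. 8–10] [cite: Serre1979, Ch. V §3 Prop. 5, Cor. 2–3] [cite: Flicker1998UnitaryFL, Prop. 7 p. 84] -/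
theorem levelsCutCensus_unr_law_of_frame [CompleteSpace E] [IsDiscreteValuationRing 𝒪[E]] [Finite 𝓀[E]]
    [CompleteSpace M] [IsDiscreteValuationRing 𝒪[M]] [Finite 𝓀[M]]
    (σ : E →+* E) (hσ : ∀ a, σ (σ a) = a) (hvσ : ∀ a, Valued.v (σ a) = Valued.v a)
    {ϖ : E} (hϖ : Valued.v ϖ = WithZero.exp (-1 : ℤ)) {d t : ℕ} (hD : IsRamifiedQuadraticDatum σ ϖ d t) (h2v : Valued.v (2 : E) < 1)
    {H₂ : Matrix (Fin 2) (Fin 2) E} (hH₂σ : (H₂.map σ)ᵀ = H₂) {H₂' : Matrix (Fin 2) (Fin 2) E} (hH₂'σ : (H₂'.map σ)ᵀ = H₂')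
    {η : E} (hη1 : Valued.v η = 1) (hησ : σ η = η) (jE : E →+* M)
    (hρρ : ∀ x, ρ (ρ x) = x) (hvρ : ∀ x, Valued.v (ρ x) = Valued.v x) (hαv : Valued.v (α - ρ α) = 1) (hα1 : Valued.v α ≤ 1)
    (hint : ∀ z : M, Valued.v z ≤ 1 → Valued.v ((z - ρ z) / (α - ρ α)) ≤ 1)
    (hΘΘ : ∀ x, Θ (Θ x) = x) (hΘρ : ∀ x, Θ (ρ x) = ρ (Θ x)) (hvΘ : ∀ x, Valued.v (Θ x) = Valued.v x) (hΘj : ∀ x, Θ (jE x) = jE (σ x))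
    (hjv : ∀ c, Valued.v (jE c) ≤ 1 ↔ Valued.v c ≤ 1) (hjfix : ∀ z, ρ z = z ↔ ∃ c, jE c = z)
    (hjpow : ∀ (t : E) (n : ℤ), Valued.v (jE t) = Valued.v (jE ϖ) ^ n ↔ Valued.v t = Valued.v ϖ ^ n)
    (hϖmax : ∀ t : M, ρ t = t → Valued.v t < 1 → Valued.v t ≤ Valued.v (jE ϖ))
    (φ : (Fin 2 → E) →+ M) (hφs : ∀ (c : E) (x : Fin 2 → E), φ (c • x) = jE c * φ x) (hφi : Function.Injective φ) (hφo : Function.Surjective φ)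
    {γ₂ : GL (Fin 2) E} {lam h : M} (hφγ : ∀ x, φ ((γ₂ : Matrix (Fin 2) (Fin 2) E).mulVec x) = lam * φ x) (hlam1 : Valued.v lam = 1)
    (hΘh : Θ h = h) (hh : h ≠ 0) (hform : ∀ x y, jE (pairing σ H₂ x y) = h * Θ (φ x) * φ y + ρ (h * Θ (φ x) * φ y))
    (φ' : (Fin 2 → E) →+ M) (hφ's : ∀ (c : E) (x : Fin 2 → E), φ' (c • x) = jE c * φ' x) (hφ'i : Function.Injective φ') (hφ'o : Function.Surjective φ')
    {γ₁ : GL (Fin 2) E} {h' : M} (hφ'γ : ∀ x, φ' ((γ₁ : Matrix (Fin 2) (Fin 2) E).mulVec x) = lam * φ' x)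
    (hΘh' : Θ h' = h') (hh' : h' ≠ 0) (hform' : ∀ x y, jE (pairing σ H₂' x y) = h' * Θ (φ' x) * φ' y + ρ (h' * Θ (φ' x) * φ' y))
    (z : M) (hz1 : Valued.v z = 1) (ξ : E) (hzξ : z * Θ z = jE ξ) (hσξ : σ ξ = ξ) (hξN : ¬ ∃ e : E, e * σ e = ξ) (u : E)
    {q : ℕ} (hqE : Nat.card 𝓀[E] = q) (hq : Nat.card 𝓀[M] = q ^ 2) (hτα : Valued.v (ρ α - Θ α) < 1)
    (hϖE : Valued.v (jE ϖ) = WithZero.exp (-1 : ℤ)) (hddE : Valued.v (jE ϖ - Θ (jE ϖ)) = Valued.v (jE ϖ) ^ d)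
    (hfixE : ∀ z : M, ρ z = z → Θ z = z → z ≠ 0 → ∃ n : ℤ, Valued.v z = WithZero.exp (2 * n))
    (h2M : Valued.v (2 : M) = Valued.v (jE ϖ) ^ t)
    (hhyper : ∃ x : M, x ≠ 0 ∧ h * Θ x * x + ρ (h * Θ x * x) = 0) (haniso : ¬ ∃ x : M, x ≠ 0 ∧ h' * Θ x * x + ρ (h' * Θ x * x) = 0)
    (hlam : lam * Θ lam = 1) (hρu : ρ (jE u) = jE u) (hu1 : jE u * Θ (jE u) = 1)
    {m jl : ℕ} (hm : Valued.v (lam - jE u) = WithZero.exp (-(m : ℤ))) (hjl : Valued.v ((lam - jE u) - ρ (lam - jE u)) = WithZero.exp (-(jl : ℤ)))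
    (hq2 : 2 ≤ q) (hd2 : 2 ≤ d) (hjl2 : jl % 2 = 0) (ε : ℤ) (hε : ε = 1 ∨ ε = -1)
    (hreal : ((ε : ℚ) = 1 ∧ m % 2 = d % 2 ∧ 1 ≤ m ∧ m + d ≤ jl) ∨ ((ε : ℚ) = -1 ∧ m = jl - d + 1 ∧ d ≤ jl))
    (a b ks T : ℕ) (hab1 : d + 2 * a ≤ b + 1) (hks : 2 * ks + 2 * ((d + a % 2) / 2) = a + a % 2 + (b + b % 2))
    (hT0 : a % 2 = 0 → T + a = ks + (d - d % 2)) (hT1 : a % 2 = 1 → T + a + 1 = ks + (d - d % 2) + 2 * (d % 2))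
    (hma : a + b + d ≤ m) {nν m₂ : ℕ} (hm₂ : m₂ + b = m + nν) {R R' : ℕ}
    (hRh0 : ∀ j b', 1 ≤ b' → IsOrd ρ α (jE ϖ ^ j) lam → (levelSetDep ρ Θ α (jE ϖ) h j b' (lam - jE u)).Nonempty → b' ≤ R)
    (hRh0' : ∀ j b', 1 ≤ b' → IsOrd ρ α (jE ϖ ^ j) lam → (levelSetDep ρ Θ α (jE ϖ) h' j b' (lam - jE u)).Nonempty → b' ≤ R')
    (hfinLS : ∀ j a', (levelSet ρ Θ α (jE ϖ) h j a').Finite) (hfinLS' : ∀ j a', (levelSet ρ Θ α (jE ϖ) h' j a').Finite)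
    (f f' : ℕ → ℕ → AddSubgroup M → ℕ)
    (hf : ∀ (b j : ℕ) (Λ : AddSubgroup M) (x₀ : M) (r : E), 1 ≤ b → x₀ ≠ 0 →
      (∀ x, x ∈ Λ ↔ ∃ z, IsOrd ρ α (jE ϖ ^ j) z ∧ x = x₀ * z) →
      IsOrd ρ α (jE ϖ ^ j) (dualGen ρ Θ α (jE ϖ ^ j) h x₀) → ¬ IsOrd ρ α (jE ϖ ^ j) (dualGen ρ Θ α (jE ϖ ^ j) h x₀ / jE ϖ) →
      Valued.v (dualGen ρ Θ α (jE ϖ ^ j) h x₀) = Valued.v (jE ϖ) ^ b →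
      (∀ b', (∀ x ∈ Λ, Valued.v (h * Θ x * b' + ρ (h * Θ x * b')) ≤ 1) → (lam - jE u) * b' ∈ Λ) →
      IsOrd ρ α (jE ϖ ^ j) lam → jE r = glueUnit ρ Θ α (jE ϖ ^ j) h (jE ϖ) (jE 1) x₀ b →
      f b j Λ = Nat.card {x : 𝒪[E] ⧸ 𝓂[E] ^ (2 * b) // ∃ u' : 𝒪[E], Ideal.Quotient.mk (𝓂[E] ^ (2 * b)) u' = x ∧
        Valued.v ((u' : E) * σ u' - r) ≤ Valued.v (ϖ ^ (2 * b))})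
    (hf' : ∀ (b j : ℕ) (Λ : AddSubgroup M) (x₀ : M) (r : E), 1 ≤ b → x₀ ≠ 0 →
      (∀ x, x ∈ Λ ↔ ∃ z, IsOrd ρ α (jE ϖ ^ j) z ∧ x = x₀ * z) →
      IsOrd ρ α (jE ϖ ^ j) (dualGen ρ Θ α (jE ϖ ^ j) h' x₀) → ¬ IsOrd ρ α (jE ϖ ^ j) (dualGen ρ Θ α (jE ϖ ^ j) h' x₀ / jE ϖ) →
      Valued.v (dualGen ρ Θ α (jE ϖ ^ j) h' x₀) = Valued.v (jE ϖ) ^ b →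
      (∀ b', (∀ x ∈ Λ, Valued.v (h' * Θ x * b' + ρ (h' * Θ x * b')) ≤ 1) → (lam - jE u) * b' ∈ Λ) →
      IsOrd ρ α (jE ϖ ^ j) lam → jE r = glueUnit ρ Θ α (jE ϖ ^ j) h' (jE ϖ) (jE η) x₀ b →
      f' b j Λ = Nat.card {x : 𝒪[E] ⧸ 𝓂[E] ^ (2 * b) // ∃ u' : 𝒪[E], Ideal.Quotient.mk (𝓂[E] ^ (2 * b)) u' = x ∧
        Valued.v ((u' : E) * σ u' - r) ≤ Valued.v (ϖ ^ (2 * b))})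
    {F : ℕ} (hH : (q - 1) * F + 2 = (q + 1) * q ^ (jl / 2)) :
    ((q : ℤ) - 1) * (q : ℤ) ^ ks *
      ((((∑ j ∈ Finset.range (jl - a + 1), (levelSet ρ Θ α (jE ϖ) h j 0).ncard) +
          ∑ b' ∈ Finset.Icc 1 R, ∑ j ∈ Finset.range (jl - a + 1),
            (if j + b' + nν ≤ m₂ + jl then ∑ᶠ Λ ∈ levelSetDep ρ Θ α (jE ϖ) h j b' ((jE ϖ ^ a)⁻¹ * (lam - jE u)), f b' j Λ else 0) : ℕ) : ℤ) -
        (((∑ j ∈ Finset.range (jl - a + 1), (levelSet ρ Θ α (jE ϖ) h' j 0).ncard) +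
          ∑ b' ∈ Finset.Icc 1 R', ∑ j ∈ Finset.range (jl - a + 1),
            (if j + b' + nν ≤ m₂ + jl then ∑ᶠ Λ ∈ levelSetDep ρ Θ α (jE ϖ) h' j b' ((jE ϖ ^ a)⁻¹ * (lam - jE u)), f' b' j Λ else 0) : ℕ) : ℤ)) =
      ε * (q : ℤ) ^ m * (((q : ℤ) - 1) * (F : ℤ) + 2 - 2 * (q : ℤ) ^ T) := by
  classical
  -- SCALARS
  have hα : ρ α ≠ α := fun h0 => by rw [h0, sub_self, map_zero] at hαv; exact zero_ne_one hαv
  have hρϖE : ρ (jE ϖ) = jE ϖ := (hjfix _).2 ⟨ϖ, rfl⟩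
  have hϖE0 : jE ϖ ≠ 0 := fun h0 => by rw [h0, map_zero] at hϖE; exact (exp_ne_zero hϖE.symm).elim
  have hϖE1 : Valued.v (jE ϖ) < 1 := by rw [hϖE, ← exp_zero, exp_lt_exp]; omega
  have hd1 : 1 ≤ d := by omega
  have hq1 : 1 ≤ q := by omega
  have hajl : a ≤ jl := by rcases hreal with ⟨-, -, -, h⟩ | ⟨-, h, h'⟩ <;> omega
  -- THE THIRD FIELD OF TYPE U (★ S2′), complete (★ §0 ∘ ★ BRIDGE-AC)
  obtain ⟨K', _iF, _iV, σ', π', jK, hDVR, hfin, hq', hσ', hvσ', hfix', hπ', hdd', hjKv, hjΘ, hjKfix, hjσ, hnorm⟩ :=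
    exists_thirdFieldPackage_unr hq hρρ hvρ hΘΘ hΘρ hvΘ hα1 hαv hτα hρϖE hϖE hddE hfixE
  haveI := hDVR; haveI := hfin
  haveI : CompleteSpace K' := completeSpace_of_v_map_eq_of_range_eq_fixed hvΘ jK hjKv hπ' hjΘ hjKfix
  haveI : IsAdicComplete 𝓂[K'] 𝒪[K'] := isAdicComplete_valuedInteger_of_completeSpace hπ'
  -- THE SCALED MULTIPLIER `μ₁ = (jE ϖ^a)⁻¹(λ − jE u)`: conductor `tc = jE ϖ^a`, tokens `(m − a, jλ − a)`
  have hρt : ρ (jE ϖ ^ a) = jE ϖ ^ a := by rw [map_pow, hρϖE]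
  have hte : Valued.v (jE ϖ ^ a) = exp (-(a : ℤ)) := by rw [map_pow, hϖE, ← exp_nsmul, nsmul_eq_mul, mul_neg, mul_one]
  have hme : (m - a) + a = m := by omega
  have hjle : (jl - a) + a = jl := by omega
  have hmS : d - d % 2 ≤ (m - a) + 1 := by omega
  have hCb : (m + jl - b) + b = m + jl := by omega
  have hbm : b ≤ m + a := by omega
  have hCle : jl - a ≤ m + jl - b := by omega
  have hCe : (m + jl - b) + d ≤ (m - a) + (jl - a) + 1 := by omega
  -- `λ`'S ORDER FILTRATION `λ ∈ 𝒪_j ⟺ j ≤ jλ`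
  have hlamρ : Valued.v (lam - ρ lam) = Valued.v (jE ϖ) ^ jl * Valued.v (α - ρ α) := by
    rw [hαv, mul_one, show lam - ρ lam = (lam - jE u) - ρ (lam - jE u) by rw [map_sub, hρu]; ring, hjl, hϖE, ← exp_nsmul,
      nsmul_eq_mul, mul_neg, mul_one]
  have hiff : ∀ j, IsOrd ρ α (jE ϖ ^ j) lam ↔ j ≤ jl := fun j => isOrd_pow_iff_le hα hϖE0 hϖE1 hlam1.le hlamρ j
  -- SCALED CELLS ⊆ UNIT CELLS (★ (β′) §1): the depth bounds transfer
  have hκ : ∀ j, IsOrd ρ α (jE ϖ ^ j) (jE ϖ ^ a) := fun j =>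
    isOrd_of_map_eq_self hρt (by rw [hte, ← exp_zero, exp_le_exp]; omega) _
  have hμ : lam - jE u = jE ϖ ^ a * ((jE ϖ ^ a)⁻¹ * (lam - jE u)) := (mul_inv_cancel_left₀ (pow_ne_zero _ hϖE0) _).symm
  have hRh : ∀ j b', 1 ≤ b' → j ≤ jl - a → (levelSetDep ρ Θ α (jE ϖ) h j b' ((jE ϖ ^ a)⁻¹ * (lam - jE u))).Nonempty → b' ≤ R :=
    fun j b' hb hj hne => hRh0 j b' hb ((hiff j).2 (by omega)) (hne.mono (levelSetDep_subset_of_eq_mul hvρ (hκ j) hμ))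
  have hRh' : ∀ j b', 1 ≤ b' → j ≤ jl - a → (levelSetDep ρ Θ α (jE ϖ) h' j b' ((jE ϖ ^ a)⁻¹ * (lam - jE u))).Nonempty → b' ≤ R' :=
    fun j b' hb hj hne => hRh0' j b' hb ((hiff j).2 (by omega)) (hne.mono (levelSetDep_subset_of_eq_mul hvρ (hκ j) hμ))
  -- THE CUTOFF LETTER `j + b′ + nν ≤ m₂ + jλ ⟺ j + b′ ≤ C` AND THE CONE WEIGHT `Σᶠ f = q^{b′}·#cell` (★ (β′)), CELL BY CELL
  have h1v : Valued.v (1 : E) = 1 := map_one _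
  have h1σ : σ 1 = 1 := map_one σ
  have hcell : ∑ b' ∈ Finset.Icc 1 R, ∑ j ∈ Finset.range (jl - a + 1),
      (if j + b' + nν ≤ m₂ + jl then ∑ᶠ Λ ∈ levelSetDep ρ Θ α (jE ϖ) h j b' ((jE ϖ ^ a)⁻¹ * (lam - jE u)), f b' j Λ else 0) =
      ∑ b' ∈ Finset.Icc 1 R, ∑ j ∈ Finset.range (jl - a + 1),
        (if j + b' ≤ m + jl - b then q ^ b' * (levelSetDep ρ Θ α (jE ϖ) h j b' ((jE ϖ ^ a)⁻¹ * (lam - jE u))).ncard else 0) := by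
    refine Finset.sum_congr rfl fun b' hb' => Finset.sum_congr rfl fun j hj => ?_
    have hb : 1 ≤ b' := (Finset.mem_Icc.1 hb').1
    have hjl' : j ≤ jl := by have := Finset.mem_range.1 hj; omega
    by_cases hc : j + b' ≤ m + jl - b
    · rw [if_pos (show j + b' + nν ≤ m₂ + jl by omega), if_pos hc,
        finsum_levelSetDep_weight_eq_pow_mul_ncard_of_eq_mul σ hσ hvσ hϖ hD h2v hH₂σ h1v h1σ jE hρρ hvρ hα hα1 hint hΘΘ hΘρ hvΘ hΘj hjv hjfix hjpow
          hϖmax φ hφs hφi hφo hφγ hlam1 hΘh hh hform z hz1 ξ hzξ hσξ hξN u _ hb ((hiff j).2 hjl') (hκ j) hμ (hfinLS j b') f hf, hqE]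
    · rw [if_neg (show ¬ (j + b' + nν ≤ m₂ + jl) from fun h0 => hc (by omega)), if_neg hc]
  have hcell' : ∑ b' ∈ Finset.Icc 1 R', ∑ j ∈ Finset.range (jl - a + 1),
      (if j + b' + nν ≤ m₂ + jl then ∑ᶠ Λ ∈ levelSetDep ρ Θ α (jE ϖ) h' j b' ((jE ϖ ^ a)⁻¹ * (lam - jE u)), f' b' j Λ else 0) =
      ∑ b' ∈ Finset.Icc 1 R', ∑ j ∈ Finset.range (jl - a + 1),
        (if j + b' ≤ m + jl - b then q ^ b' * (levelSetDep ρ Θ α (jE ϖ) h' j b' ((jE ϖ ^ a)⁻¹ * (lam - jE u))).ncard else 0) := by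
    refine Finset.sum_congr rfl fun b' hb' => Finset.sum_congr rfl fun j hj => ?_
    have hb : 1 ≤ b' := (Finset.mem_Icc.1 hb').1
    have hjl' : j ≤ jl := by have := Finset.mem_range.1 hj; omega
    by_cases hc : j + b' ≤ m + jl - b
    · rw [if_pos (show j + b' + nν ≤ m₂ + jl by omega), if_pos hc,
        finsum_levelSetDep_weight_eq_pow_mul_ncard_of_eq_mul σ hσ hvσ hϖ hD h2v hH₂'σ hη1 hησ jE hρρ hvρ hα hα1 hint hΘΘ hΘρ hvΘ hΘj hjv hjfix hjpow
          hϖmax φ' hφ's hφ'i hφ'o hφ'γ hlam1 hΘh' hh' hform' z hz1 ξ hzξ hσξ hξN u _ hb ((hiff j).2 hjl') (hκ j) hμ (hfinLS' j b') f' hf', hqE]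
    · rw [if_neg (show ¬ (j + b' + nν ≤ m₂ + jl) from fun h0 => hc (by omega)), if_neg hc]
  rw [hcell, hcell']
  -- THE WELD (★ p860069, lane by `a % 2`) ∘ THE LAW (★ generic arithmetic) ∘ THE INERT `ℤ` BOTTOM
  rcases Nat.mod_two_eq_zero_or_one a with ha2 | ha2
  · have hjl2' : (jl - a) % 2 = 0 := by omega
    have hreal₁ : ((ε : ℚ) = 1 ∧ (m - a) % 2 = d % 2 ∧ 1 ≤ m - a ∧ (m - a) + d ≤ jl - a) ∨ ((ε : ℚ) = -1 ∧ m - a = (jl - a) - d + 1 ∧ d ≤ jl - a) := by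
      rcases hreal with ⟨h1, h2, h3, h4⟩ | ⟨h1, h2, h3⟩
      · exact Or.inl ⟨h1, by omega, by omega, by omega⟩
      · exact Or.inr ⟨h1, by omega, by omega⟩
    have hweld := levelOrderCounts_unr_weld_cut hρρ hvρ hΘΘ hΘρ hvΘ hα1 hαv hρϖE hϖE hq h2M hσ' hvσ' hfix' hπ' hdd' hd1 hq' jK hjKv hjΘ hjKfix hjσ
      hnorm hΘh hh hhyper hΘh' hh' haniso hlam hρu hu1 hm hjl hρt hte hme hjle hq2 hd2 hjl2' hmS (ε : ℚ) hreal₁ (m + jl - b) hCle hCe hRh hRh'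
    have hlaw := law_arith_unr_std q ha2 hjl2 hab1 hd2 hks (hT0 ha2) hme hjle hCb hbm
      (hreal₁.imp (fun h0 => h0.2) (fun h0 => h0.2))
    exact levels_bottom_arith_inert hε hweld hlaw hH hq1
  · have hjl2' : (jl - a) % 2 = 1 := by omega
    have hreal₁ : ((ε : ℚ) = 1 ∧ (m - a) % 2 ≠ d % 2 ∧ 1 ≤ m - a ∧ (m - a) + d ≤ jl - a) ∨ ((ε : ℚ) = -1 ∧ m - a = (jl - a) - d + 1 ∧ d ≤ jl - a) := by
      rcases hreal with ⟨h1, h2, h3, h4⟩ | ⟨h1, h2, h3⟩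
      · exact Or.inl ⟨h1, by omega, by omega, by omega⟩
      · exact Or.inr ⟨h1, by omega, by omega⟩
    have hweld := levelOrderCounts_unr_weld_cut_flip hρρ hvρ hΘΘ hΘρ hvΘ hα1 hαv hρϖE hϖE hq h2M hσ' hvσ' hfix' hπ' hdd' hd1 hq' jK hjKv hjΘ hjKfix hjσ
      hnorm hΘh hh hhyper hΘh' hh' haniso hlam hρu hu1 hm hjl hρt hte hme hjle hq2 hd2 hjl2' hmS (ε : ℚ) hreal₁ (m + jl - b) hCle hCe hRh hRh'
    have hlaw := law_arith_unr_flip q ha2 hjl2 hab1 hd2 hks (hT1 ha2) hme hjle hCb hbm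
      (hreal₁.imp (fun h0 => h0.2) (fun h0 => h0.2))
    exact levels_bottom_arith_inert hε hweld hlaw hH hq1

end Summit.HodgeConjecture.HodgeConjecture.Cruxes.H413.F0P3cDyRamLevelsCensusUnrFrameLaw

end
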